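import Summits.AtomisticToContinuum.Crystallization.Theorems.FrustratedLawDichotomyStrainedPatchHomLeafTableFcc

/-!
# v2 leaf checker — Boolean certificate for the COVERAGE of the near-label list (all box labels of fcc norm ≤ 35, up to sign)

decomp-a2c hand-1 g20 (crux `AperiodicFrustratedLawGap`, stmt-AtomisticToContinuum-27623).  `coverCheck labs` enumerates `[−7,7]³` by three `List.range 15`
loops and tests, for every non-zero triple of fcc norm `≤ 35`, that it or its negative is the label of a record; `cover_of_coverCheck` turns `coverCheck labs =
true` (one kernel `decide` on the literal list) into the coverage hypothesis of `leafCheck_sound_fcc`.  0 sorry; standard axioms.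
`--supports stmt-AtomisticToContinuum-27623`.
-/

namespace Summit.AtomisticToContinuum.Crystallization.Theorems.FrustratedLawDichotomyStrainedPatchHomLeafTableCheck

/-- The record's label is `(x, y, z)` or `(−x, −y, −z)`. -/
def NL.hit (x y z : ℤ) (l : NL) : Bool :=
  (decide (l.b0 = x) && decide (l.b1 = y) && decide (l.b2 = z)) || (decide (l.b0 = -x) && decide (l.b1 = -y) && decide (l.b2 = -z))

/-- A triple is irrelevant (zero, or fcc norm `> 35`) or hit by the list. -/
def coverTriple (labs : List NL) (x y z : ℤ) : Bool :=
  decide (x = 0 ∧ y = 0 ∧ z = 0) || decide (35 < x * x + y * y + z * z + x * y + x * z + y * z) || labs.any (NL.hit x y z)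

/-- ★ Coverage check over `[−7,7]³`. -/
def coverCheck (labs : List NL) : Bool :=
  (List.range 15).all fun i => (List.range 15).all fun j => (List.range 15).all fun k =>
    coverTriple labs ((i : ℤ) - 7) ((j : ℤ) - 7) ((k : ℤ) - 7)

/-- A hit record has the label or its negative. [formal bookkeeping] -/
theorem NL.toLab_of_hit {x y z : ℤ} {l : NL} (h : l.hit x y z = true) : l.toLab = ![x, y, z] ∨ l.toLab = -![x, y, z] := by
  unfold NL.hit at h
  simp only [Bool.or_eq_true, Bool.and_eq_true, decide_eq_true_eq] at h
  rcases h with ⟨⟨h0, h1⟩, h2⟩ | ⟨⟨h0, h1⟩, h2⟩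
  · left; ext i; fin_cases i <;> simp [NL.toLab, h0, h1, h2]
  · right; ext i; fin_cases i <;> simp [NL.toLab, h0, h1, h2]

/-- ★ `coverCheck labs = true` ⟹ every box label of fcc norm `≤ 35` is, up to sign, the label of a record. [formal bookkeeping] -/
theorem cover_of_coverCheck {labs : List NL} (h : coverCheck labs = true) :
    ∀ b ∈ (Fintype.piFinset fun _ : Fin 3 => Finset.Icc (-7 : ℤ) 7).filter (fun b => b ≠ 0), nbZ b ≤ 35 →
      ∃ l ∈ labs, l.toLab = b ∨ l.toLab = -b := by
  intro b hb hnb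
  rw [mem_box7_iff] at hb
  obtain ⟨hbd, hne⟩ := hb
  -- the indices of `b` in the three loops
  have hidx : ∀ t : Fin 3, ∃ n : ℕ, n < 15 ∧ (n : ℤ) - 7 = b t := fun t =>
    ⟨(b t + 7).toNat, by have := hbd t; omega, by have := hbd t; omega⟩
  obtain ⟨i, hi15, hi⟩ := hidx 0
  obtain ⟨j, hj15, hj⟩ := hidx 1
  obtain ⟨k, hk15, hk⟩ := hidx 2
  unfold coverCheck at h
  have h1 := List.all_eq_true.1 h i (List.mem_range.2 hi15)
  have h2 := List.all_eq_true.1 h1 j (List.mem_range.2 hj15)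
  have h3 := List.all_eq_true.1 h2 k (List.mem_range.2 hk15)
  rw [hi, hj, hk] at h3
  unfold coverTriple at h3
  simp only [Bool.or_eq_true, decide_eq_true_eq, List.any_eq_true] at h3
  have hbvec : b = ![b 0, b 1, b 2] := by ext t; fin_cases t <;> rfl
  rcases h3 with (hz | hbig) | ⟨l, hl, hhit⟩
  · exact absurd (by rw [hbvec]; ext t; fin_cases t <;> simp [hz.1, hz.2.1, hz.2.2]) hne
  · exact absurd hnb (by unfold nbZ; omega)
  · refine ⟨l, hl, ?_⟩
    rw [hbvec]
    exact NL.toLab_of_hit hhit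

end Summit.AtomisticToContinuum.Crystallization.Theorems.FrustratedLawDichotomyStrainedPatchHomLeafTableCheck
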